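import Summits.SmoothPoincare4.SmoothPoincare4.Theorems.EntropyRungSubcylindricalRecognitionConeCore
import Summits.SmoothPoincare4.SmoothPoincare4.Theorems.EntropyRungSubcylindricalRecognitionInjOnVolumeComparison
import Summits.SmoothPoincare4.SmoothPoincare4.Theorems.EntropyRungSubcylindricalRecognitionConeAnnulusArithmetic
import Literature.Geometry.Riemannian.BamlerTangentFlowAtInfinity
import Literature.Geometry.Riemannian.RicciFlowMaximal
import Literature.Geometry.Riemannian.PerelmanEntropyScaling
import Literature.Geometry.Riemannian.RicciFlowScaling
import Literature.Geometry.Riemannian.MetricTraceScaling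
import Literature.Geometry.Riemannian.RicciFlowScalarCurvatureHolds
import Literature.Geometry.Riemannian.RiemannianDistance
import HarnessLib

/-!
# The Bamler blow-down of the blow-up sequence, closed modulo the named fact (line `ancient-sphere-rigidity`)

Crux `EntropyRung.SubcylindricalRecognition` (stmt-SmoothPoincare4-10869), line `ancient-sphere-rigidity`,
skeleton r6. `stub_blowdownSoliton_of` (registered): r4's stub `stub_blowdownSoliton` — a complete smooth
connected gradient shrinker in Bamler's normalisation with `W ≥ ν_cyl + δ'`, `R > 0`,
`∫ e^{-f} = 16π²`, and `S` compact ⇒ injective immersion `S → M`, from the blow-up sequence of rescaled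
compact Ricci flows with the entropy floor — PROVED MODULO the named fact
`Literature.Geometry.Riemannian.bamler_orbifoldTangentFlowAtInfinity_four` (Bamler 2020a–c, smooth export):
run the export with `F = ν_cyl + δ'`; a cone point of the blow-down orbifold shrinker is excluded on a
rescaled slice `Q g_k(t)` of the compact approximants by `coneCore` (Γ-invariant Gaussian annulus test
function: `μ(Q g_k(t), τ) < ν_cyl + δ'`, against the floor `μ(Q g, τ) = μ(g, τ/Q) ≥ ν_cyl + δ'`, where
`ν_cyl + δ' > -log 2 ≥ -log |Γ|`); with no cone point the export is the statement verbatim. Uses the landed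
stubs `stub_injOnVolumeComparison`, `stub_coneAnnulusArithmetic`, and `coneCore`
(`stub_muEntropyTestFunction`, `stub_multiplicityLintegral`). In the skeleton this is
`stub_blowdownAssembly stub_orbifoldTangentFlow …`.
-/

noncomputable section

open scoped Manifold ContDiff Topology ENNReal NNReal ContinuousMap
open Set MeasureTheory Filter
open Literature.Geometry.Lorentzian Literature.Geometry.Riemannian

namespace Summit.SmoothPoincare4.SmoothPoincare4.Theorems.SubcylindricalRecognition.AncientSphereRigidity

/-- **The cone branch.** For one cone point of the blow-down (sheet number `k ≥ 2`, chart radius `r`,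
chart metric `G` Euclidean at the vertex, scalar-curvature constant `Λ₀`, and the transplant clause of the
Bamler export), the entropy floor `ν_cyl + δ' ≤ μ(g_k(t), τ)` on the compact flows is contradictory:
`coneCore` on the rescaled slice `Q g_k(t)`. [folklore] -/
theorem coneBranch_false
    (M : Type) [TopologicalSpace M] [T2Space M] [SecondCountableTopology M]
    [ChartedSpace (EuclideanSpace ℝ (Fin 4)) M] [IsManifold (𝓡 4) ∞ M] [CompactSpace M]
    [T3Space M] [MeasurableSpace M] [BorelSpace M]
    (A : ℕ → ℝ)
    (gk : ℕ → ℝ → PseudoRiemannianMetric (𝓡 4) ∞ (EuclideanSpace ℝ (Fin 4)) (TangentSpace (𝓡 4) : M → Type _))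
    (covk : ℕ → ℝ → CovariantDerivative (𝓡 4) (EuclideanSpace ℝ (Fin 4)) (TangentSpace (𝓡 4) : M → Type _))
    (δ' : ℝ) (hδ' : 0 < δ')
    (hflow : ∀ k, IsRicciFlow (gk k) (covk k) (Set.Icc (-(A k)) 0))
    (hRiem : ∀ k, ∀ t ∈ Set.Icc (-(A k)) 0, (gk k t).IsRiemannian)
    (hfloor : ∀ k, ∀ t ∈ Set.Icc (-(A k)) 0, ∀ τ : ℝ, 0 < τ →
      ((Real.log 2 + Real.log Real.pi / 2 - 3 / 2 + δ' : ℝ) : EReal) ≤ (gk k t).muEntropy (covk k t) τ)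
    (k : ℕ) (hk2 : 2 ≤ k) (r Λ₀ : ℝ) (hrpos : 0 < r) (hΛnn : 0 ≤ Λ₀)
    (G : EuclideanSpace ℝ (Fin 4) → (EuclideanSpace ℝ (Fin 4) →L[ℝ] EuclideanSpace ℝ (Fin 4) →L[ℝ] ℝ))
    (hgcs : ContDiffOn ℝ ∞ G (Metric.ball 0 r))
    (hgc0 : ∀ v w : EuclideanSpace ℝ (Fin 4), G 0 v w = inner ℝ v w)
    (htrans : ∀ ε η : ℝ, 0 < ε → ε < r → 0 < η →
      ∃ (kₓ : ℕ) (t : ℝ) (_ : t ∈ Set.Icc (-(A kₓ)) 0) (Q : ℝ) (_ : 0 < Q)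
        (Φ : EuclideanSpace ℝ (Fin 4) → M) (ρ : M → ℝ),
        ContMDiffOn (𝓡 4) (𝓡 4) ∞ Φ (Metric.ball 0 r \ Metric.closedBall 0 ε) ∧
        IsOpen (Φ '' (Metric.ball 0 r \ Metric.closedBall 0 ε)) ∧
        (∀ y ∈ Metric.ball (0 : EuclideanSpace ℝ (Fin 4)) r \ Metric.closedBall 0 ε,
          Function.Injective (mfderiv (𝓡 4) (𝓡 4) Φ y)) ∧
        (∀ y ∈ Metric.ball (0 : EuclideanSpace ℝ (Fin 4)) r \ Metric.closedBall 0 ε,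
          (Φ ⁻¹' {Φ y} ∩ (Metric.ball 0 r \ Metric.closedBall 0 ε)).ncard = k) ∧
        ContMDiffOn (𝓡 4) 𝓘(ℝ, ℝ) ∞ ρ (Φ '' (Metric.ball 0 r \ Metric.closedBall 0 ε)) ∧
        (∀ y ∈ Metric.ball (0 : EuclideanSpace ℝ (Fin 4)) r \ Metric.closedBall 0 ε,
          ρ (Φ y) = ‖y‖ ^ 2) ∧
        (∀ y ∈ Metric.ball (0 : EuclideanSpace ℝ (Fin 4)) r \ Metric.closedBall 0 ε,
          ∀ v : EuclideanSpace ℝ (Fin 4),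
            (1 - η) * G y v v ≤
              Q * (gk kₓ t).val (Φ y) (mfderiv (𝓡 4) (𝓡 4) Φ y v) (mfderiv (𝓡 4) (𝓡 4) Φ y v) ∧
            Q * (gk kₓ t).val (Φ y) (mfderiv (𝓡 4) (𝓡 4) Φ y v) (mfderiv (𝓡 4) (𝓡 4) Φ y v) ≤
              (1 + η) * G y v v) ∧
        (∀ y ∈ Metric.ball (0 : EuclideanSpace ℝ (Fin 4)) r \ Metric.closedBall 0 ε,
          |(gk kₓ t).scalarCurvatureWith (covk kₓ t) (Φ y)| ≤ Q * Λ₀)) : False := by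
  have hk1 : 1 ≤ k := le_trans (by norm_num) hk2
  obtain ⟨m, hm⟩ : ∃ m : ℝ, m = Real.log 2 + Real.log Real.pi / 2 - 3 / 2 + δ' := ⟨_, rfl⟩
  have hmk : -Real.log k < m := hm ▸ neg_log_lt_nuCyl_add hk2 hδ'
  obtain ⟨η₀, hη₀, c₀, hc₀, harith⟩ := stub_coneAnnulusArithmetic k hk1 m hmk
  -- parameters `η`, `r₁`, `Λ`, `τ`, `ε`
  obtain ⟨η, hηdef⟩ : ∃ η : ℝ, η = min η₀ (1 / 2) := ⟨_, rfl⟩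
  have hηpos : 0 < η := hηdef ▸ lt_min hη₀ (by norm_num)
  have hηle : η ≤ η₀ := hηdef ▸ min_le_left _ _
  have hηhalf : η ≤ 1 / 2 := hηdef ▸ min_le_right _ _
  have hη1 : η < 1 := by linarith only [hηhalf]
  have hθpos : 0 < η / 3 := by positivity
  obtain ⟨r₁, hr₁, hr₁r, hgcmp⟩ :=
    exists_ball_sq_norm_comparison hrpos hθpos hgcs.continuousOn hgc0
  have hΛ1 : 0 < Λ₀ + 1 := by linarith only [hΛnn]
  obtain ⟨τ, hτdef⟩ : ∃ τ : ℝ, τ = min (c₀ / (Λ₀ + 1)) (c₀ * r₁ ^ 2) / 2 := ⟨_, rfl⟩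
  have hq1 : 0 < c₀ / (Λ₀ + 1) := div_pos hc₀ hΛ1
  have hq2 : 0 < c₀ * r₁ ^ 2 := by positivity
  have hτpos : 0 < τ := by rw [hτdef]; exact div_pos (lt_min hq1 hq2) two_pos
  have hτ1 : τ ≤ c₀ / (Λ₀ + 1) := by
    have := min_le_left (c₀ / (Λ₀ + 1)) (c₀ * r₁ ^ 2)
    rw [hτdef]; linarith only [this, hq1]
  have hτ2 : τ ≤ c₀ * r₁ ^ 2 := by
    have := min_le_right (c₀ / (Λ₀ + 1)) (c₀ * r₁ ^ 2)
    rw [hτdef]; linarith only [this, hq2]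
  have hΛτ : Λ₀ * τ ≤ c₀ := by
    calc Λ₀ * τ ≤ Λ₀ * (c₀ / (Λ₀ + 1)) := mul_le_mul_of_nonneg_left hτ1 hΛnn
      _ ≤ (Λ₀ + 1) * (c₀ / (Λ₀ + 1)) :=
          mul_le_mul_of_nonneg_right (by linarith only) hq1.le
      _ = c₀ := by field_simp
  obtain ⟨ε, hεdef⟩ : ∃ ε : ℝ, ε = min (Real.sqrt (c₀ * τ)) r₁ / 2 := ⟨_, rfl⟩
  have hsqrtpos : 0 < Real.sqrt (c₀ * τ) := Real.sqrt_pos.mpr (by positivity)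
  have hεpos : 0 < ε := by rw [hεdef]; exact div_pos (lt_min hsqrtpos hr₁) two_pos
  have hεr₁ : ε ≤ r₁ / 2 := by
    have := min_le_right (Real.sqrt (c₀ * τ)) r₁
    rw [hεdef]; linarith only [this]
  have hεsq : ε ^ 2 ≤ c₀ * τ := by
    have h1 : ε ≤ Real.sqrt (c₀ * τ) / 2 := by
      have := min_le_left (Real.sqrt (c₀ * τ)) r₁
      rw [hεdef]; linarith only [this]
    have h2 : ε ^ 2 ≤ (Real.sqrt (c₀ * τ) / 2) ^ 2 := pow_le_pow_left₀ hεpos.le h1 2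
    have h3 : (Real.sqrt (c₀ * τ) / 2) ^ 2 = c₀ * τ / 4 := by
      rw [div_pow, Real.sq_sqrt (by positivity)]; norm_num
    have h4 : 0 ≤ c₀ * τ := by positivity
    linarith only [h2, h3, h4]
  have hεlt : ε < r := by linarith only [hεr₁, hr₁r, hr₁]
  have hεr₁' : 8 * ε ^ 2 < 3 * r₁ ^ 2 := by nlinarith only [hεr₁, hεpos, hr₁]
  -- transplant an annulus of the cone chart into a rescaled slice of the compact flows
  obtain ⟨kₓ, t, ht, Q, hQ, Φ, ρ, hΦs, hopen, hmf, hfib, hρs, hdesc, hcmp, hRb⟩ :=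
    htrans ε (η / 3) hεpos hεlt hθpos
  obtain ⟨Abig, hAbig⟩ : ∃ Abig : Set (EuclideanSpace ℝ (Fin 4)),
      Abig = Metric.ball 0 r \ Metric.closedBall 0 ε := ⟨_, rfl⟩
  rw [← hAbig] at hΦs hopen hmf hfib hρs hdesc hcmp hRb
  obtain ⟨A', hA'⟩ : ∃ A' : Set (EuclideanSpace ℝ (Fin 4)),
      A' = Metric.ball 0 r₁ \ Metric.closedBall 0 ε := ⟨_, rfl⟩
  have hA'sub : A' ⊆ Abig := by
    rw [hA', hAbig]; exact Set.sdiff_subset_sdiff_left (Metric.ball_subset_ball hr₁r.le)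
  have hmemA' : ∀ {y : EuclideanSpace ℝ (Fin 4)}, y ∈ A' ↔ ε < ‖y‖ ∧ ‖y‖ < r₁ := by
    intro y
    simp only [hA', Set.mem_sdiff, Metric.mem_ball, dist_zero_right, Metric.mem_closedBall, not_le]
    tauto
  have hmemAbig : ∀ {y : EuclideanSpace ℝ (Fin 4)}, y ∈ Abig ↔ ε < ‖y‖ ∧ ‖y‖ < r := by
    intro y
    simp only [hAbig, Set.mem_sdiff, Metric.mem_ball, dist_zero_right, Metric.mem_closedBall, not_le]
    tauto
  -- fibres over `A'` stay in `A'`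
  have hfibre : ∀ y ∈ A', ∀ y' ∈ Abig, Φ y' = Φ y → y' ∈ A' := by
    intro y hy y' hy' hyy
    have h1 : ‖y'‖ ^ 2 = ‖y‖ ^ 2 := by rw [← hdesc y' hy', ← hdesc y (hA'sub hy), hyy]
    have h2 : ‖y'‖ = ‖y‖ := by
      rcases abs_eq_abs.mp ((sq_eq_sq_iff_abs_eq_abs _ _).mp h1) with h | h
      · exact h
      · linarith only [h, norm_nonneg y, norm_nonneg y']
    rw [hmemA', h2]; exact hmemA'.mp hy
  -- the image `Φ A'` is open
  have hopen' : IsOpen (Φ '' A') := by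
    have heq : Φ '' A' = Φ '' Abig ∩ ρ ⁻¹' Set.Iio (r₁ ^ 2) := by
      ext x
      constructor
      · rintro ⟨y, hy, rfl⟩
        refine ⟨mem_image_of_mem Φ (hA'sub hy), ?_⟩
        rw [Set.mem_preimage, hdesc y (hA'sub hy), Set.mem_Iio]
        have h0 := norm_nonneg y
        have h1 := (hmemA'.mp hy).2
        nlinarith only [h0, h1]
      · rintro ⟨⟨y, hy, rfl⟩, hlt⟩
        rw [Set.mem_preimage, hdesc y hy, Set.mem_Iio] at hlt
        refine mem_image_of_mem Φ ?_
        rw [hmemA']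
        refine ⟨(hmemAbig.mp hy).1, ?_⟩
        by_contra hge
        rw [not_lt] at hge
        nlinarith only [hlt, hge, hr₁]
    rw [heq]
    exact hρs.continuousOn.isOpen_inter_preimage hopen isOpen_Iio
  -- the rescaled slice `h = Q g_k(t)`
  have hgR : (gk kₓ t).IsRiemannian := hRiem kₓ t ht
  have hhR : ((gk kₓ t).constSmul Q hQ.ne').IsRiemannian := hgR.constSmul hQ
  have hRg : ContMDiff (𝓡 4) 𝓘(ℝ, ℝ) ∞ (fun x ↦ (gk kₓ t).scalarCurvatureWith (covk kₓ t) x) :=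
    contMDiff_scalarCurvatureWith_holds (𝓡 4) M (gk kₓ t) (covk kₓ t) ((hflow kₓ).isLeviCivita t ht)
  have hRh : Continuous fun x ↦ ((gk kₓ t).constSmul Q hQ.ne').scalarCurvatureWith (covk kₓ t) x := by
    have heq : (fun x ↦ ((gk kₓ t).constSmul Q hQ.ne').scalarCurvatureWith (covk kₓ t) x) =
        fun x ↦ Q⁻¹ * (gk kₓ t).scalarCurvatureWith (covk kₓ t) x :=
      funext fun x ↦ (gk kₓ t).scalarCurvatureWith_constSmul Q hQ.ne' (covk kₓ t) x
    rw [heq]; exact continuous_const.mul hRg.continuous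
  -- the floor on the rescaled slice
  have hfloor_h : (m : EReal) ≤ ((gk kₓ t).constSmul Q hQ.ne').muEntropy (covk kₓ t) τ := by
    rw [(gk kₓ t).muEntropy_constSmul' (covk kₓ t) hQ hτpos, hm]
    exact hfloor kₓ t ht (τ / Q) (div_pos hτpos hQ)
  -- the comparison for `h` on `A'`
  have hcomp' : ∀ y ∈ A', ∀ v : EuclideanSpace ℝ (Fin 4),
      (1 - η) * ‖v‖ ^ 2 ≤ ((gk kₓ t).constSmul Q hQ.ne').val (Φ y) (mfderiv (𝓡 4) (𝓡 4) Φ y v)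
        (mfderiv (𝓡 4) (𝓡 4) Φ y v) ∧
      ((gk kₓ t).constSmul Q hQ.ne').val (Φ y) (mfderiv (𝓡 4) (𝓡 4) Φ y v)
        (mfderiv (𝓡 4) (𝓡 4) Φ y v) ≤ (1 + η) * ‖v‖ ^ 2 := by
    intro y hy v
    have hyb : y ∈ Metric.ball (0 : EuclideanSpace ℝ (Fin 4)) r₁ := by
      rw [Metric.mem_ball, dist_zero_right]; exact (hmemA'.mp hy).2
    obtain ⟨hc1, hc2⟩ := hgcmp y hyb v
    obtain ⟨ht1, ht2⟩ := hcmp y (hA'sub hy) v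
    rw [(gk kₓ t).constSmul_apply]
    have hv0 : 0 ≤ ‖v‖ ^ 2 := sq_nonneg _
    have hθ1 : 0 ≤ 1 - η / 3 := by linarith only [hη1]
    have hθ2 : 0 ≤ 1 + η / 3 := by linarith only [hηpos]
    have hη3 : 0 ≤ η / 3 := div_nonneg hηpos.le (by norm_num)
    constructor
    · have e1 : (1 - η) * ‖v‖ ^ 2 ≤ (1 - η / 3) * ((1 - η / 3) * ‖v‖ ^ 2) := by
        have key : (1 - η / 3) * ((1 - η / 3) * ‖v‖ ^ 2) - (1 - η) * ‖v‖ ^ 2 =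
            (η / 3 + η ^ 2 / 9) * ‖v‖ ^ 2 := by ring
        have hnn : 0 ≤ (η / 3 + η ^ 2 / 9) * ‖v‖ ^ 2 :=
          mul_nonneg (add_nonneg hη3 (div_nonneg (sq_nonneg η) (by norm_num))) hv0
        rw [← key] at hnn
        exact sub_nonneg.mp hnn
      have e2 : (1 - η / 3) * ((1 - η / 3) * ‖v‖ ^ 2) ≤ (1 - η / 3) * G y v v :=
        mul_le_mul_of_nonneg_left hc1 hθ1
      exact e1.trans (e2.trans ht1)
    · have e2 : (1 + η / 3) * G y v v ≤ (1 + η / 3) * ((1 + η / 3) * ‖v‖ ^ 2) :=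
        mul_le_mul_of_nonneg_left hc2 hθ2
      have e3 : (1 + η / 3) * ((1 + η / 3) * ‖v‖ ^ 2) ≤ (1 + η) * ‖v‖ ^ 2 := by
        have key : (1 + η) * ‖v‖ ^ 2 - (1 + η / 3) * ((1 + η / 3) * ‖v‖ ^ 2) =
            η / 9 * (3 - η) * ‖v‖ ^ 2 := by ring
        have h3η : 0 ≤ 3 - η := by linarith only [hη1]
        have hnn : 0 ≤ η / 9 * (3 - η) * ‖v‖ ^ 2 :=
          mul_nonneg (mul_nonneg (div_nonneg hηpos.le (by norm_num)) h3η) hv0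
        rw [← key] at hnn
        exact sub_nonneg.mp hnn
      exact ht2.trans (e2.trans e3)
  -- scalar curvature of `h` on `Φ A'`
  have hRΛ' : ∀ y ∈ A', |((gk kₓ t).constSmul Q hQ.ne').scalarCurvatureWith (covk kₓ t) (Φ y)| ≤ Λ₀ := by
    intro y hy
    rw [(gk kₓ t).scalarCurvatureWith_constSmul Q hQ.ne' (covk kₓ t), abs_mul, abs_inv, abs_of_pos hQ,
      inv_mul_le_iff₀ hQ]
    exact hRb y (hA'sub hy)
  -- fibres and the arithmetic
  have hfib' : ∀ y ∈ A', (Φ ⁻¹' {Φ y} ∩ A').ncard = k := by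
    intro y hy
    have heq : Φ ⁻¹' {Φ y} ∩ A' = Φ ⁻¹' {Φ y} ∩ Abig := by
      ext y'
      constructor
      · rintro ⟨h1, h2⟩; exact ⟨h1, hA'sub h2⟩
      · rintro ⟨h1, h2⟩; exact ⟨h1, hfibre y hy y' h2 h1⟩
    rw [heq]; exact hfib y (hA'sub hy)
  have harith' := harith η τ Λ₀ ε r₁ hηpos.le hηle hτpos hΛnn hΛτ hεpos hεsq hr₁ hτ2
  rw [hA'] at hopen' hfib' hcomp' hRΛ' hA'sub
  have hper' : ∀ U ⊆ Metric.ball (0 : EuclideanSpace ℝ (Fin 4)) r₁ \ Metric.closedBall 0 ε, IsOpen U →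
      Set.InjOn Φ U → ∀ S ⊆ U, MeasurableSet S →
        ENNReal.ofReal ((1 - η) ^ 2) * volume S ≤ ((gk kₓ t).constSmul Q hQ.ne').riemVolume (Φ '' S) ∧
          ((gk kₓ t).constSmul Q hQ.ne').riemVolume (Φ '' S) ≤ ENNReal.ofReal ((1 + η) ^ 2) * volume S := by
    intro U hUA hUo hinjU S hSU hS
    exact stub_injOnVolumeComparison M _ hhR Φ U η hηpos.le hη1 hUo (hΦs.mono (hUA.trans hA'sub)) hinjU
      (fun y hy v ↦ hcomp' y (hUA hy) v) S hSU hS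
  have hlt := coneCore M ((gk kₓ t).constSmul Q hQ.ne') hhR (covk kₓ t) hRh k hk1
    m η τ Λ₀ ε r₁ hη1 hτpos hεpos hr₁ hεr₁' Φ ρ (hΦs.mono hA'sub) hopen'
    (fun y hy ↦ hmf y (hA'sub hy)) hfib' (hρs.mono (image_mono hA'sub))
    (fun y hy ↦ hdesc y (hA'sub hy)) (fun y hy v ↦ (hcomp' y hy v).1) hRΛ' hper' harith'
  exact absurd hfloor_h (not_le.mpr hlt)


/-- **r4's `stub_blowdownSoliton`, PROVED MODULO Bamler's orbifold tangent flow at `-∞`** (the named fact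
`Literature.Geometry.Riemannian.bamler_orbifoldTangentFlowAtInfinity_four`). [cite: Bamler2020Structure, §2.7 Thm 2.40; §2.10 Thm 2.46] -/
theorem stub_blowdownSoliton_of :
    Literature.Geometry.Riemannian.bamler_orbifoldTangentFlowAtInfinity_four →
        ∀ (M : Type) [TopologicalSpace M] [T2Space M] [SecondCountableTopology M]
          [ChartedSpace (EuclideanSpace ℝ (Fin 4)) M] [IsManifold (𝓡 4) ∞ M] [CompactSpace M]
          [ConnectedSpace M] [T3Space M] [MeasurableSpace M] [BorelSpace M]
          (A : ℕ → ℝ)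
          (gk : ℕ → ℝ → PseudoRiemannianMetric (𝓡 4) ∞ (EuclideanSpace ℝ (Fin 4)) (TangentSpace (𝓡 4) : M → Type _))
          (covk : ℕ → ℝ → CovariantDerivative (𝓡 4) (EuclideanSpace ℝ (Fin 4)) (TangentSpace (𝓡 4) : M → Type _))
          (xk : ℕ → M) (δ' c : ℝ), 0 < δ' → 0 < c →
          (∀ k : ℕ, (k : ℝ) ≤ A k) →
          (∀ k, IsRicciFlow (gk k) (covk k) (Set.Icc (-(A k)) 0)) →
          (∀ k, ∀ t ∈ Set.Icc (-(A k)) 0, (gk k t).IsRiemannian) →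
          (∀ k, ∀ t ∈ Set.Icc (-(A k)) 0, CurvatureBoundedBy (gk k t) (covk k t) 1) →
          (∀ k, ∃ X Y Z W : TangentSpace (𝓡 4) (xk k),
            (gk k 0).val (xk k) X X ≤ 1 ∧ (gk k 0).val (xk k) Y Y ≤ 1 ∧
            (gk k 0).val (xk k) Z Z ≤ 1 ∧ (gk k 0).val (xk k) W W ≤ 1 ∧
            c ≤ |(gk k 0).curvatureForm (covk k 0) (xk k) X Y Z W|) →
          (∀ k, ∀ t ∈ Set.Icc (-(A k)) 0, ∀ τ : ℝ, 0 < τ →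
            ((Real.log 2 + Real.log Real.pi / 2 - 3 / 2 + δ' : ℝ) : EReal) ≤
              (gk k t).muEntropy (covk k t) τ) →
          ∃ (S : Type) (_ : TopologicalSpace S) (_ : T2Space S) (_ : SecondCountableTopology S)
            (_ : ChartedSpace (EuclideanSpace ℝ (Fin 4)) S) (_ : IsManifold (𝓡 4) ∞ S) (_ : ConnectedSpace S)
            (_ : T3Space S) (_ : MeasurableSpace S) (_ : BorelSpace S)
            (gS : PseudoRiemannianMetric (𝓡 4) ∞ (EuclideanSpace ℝ (Fin 4)) (TangentSpace (𝓡 4) : S → Type _))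
            (_ : gS.HasLeviCivita) (f : S → ℝ) (hS : gS.IsRiemannian) (W : ℝ),
            (∀ (x : S) (r : NNReal), IsCompact {y : S | gS.edist hS x y ≤ r}) ∧
            ContMDiff (𝓡 4) 𝓘(ℝ, ℝ) ∞ f ∧
            (∀ (x : S) (X Y : TangentSpace (𝓡 4) x),
              gS.ricci x X Y + gS.hessian f x X Y = (1 / 2 : ℝ) * gS.val x X Y) ∧
            (∀ x : S, gS.scalarCurvature x + gS.gradSq f x = f x - W) ∧
            ∫⁻ x, ENNReal.ofReal (Real.exp (-f x))
                ∂(riemannianMeasure (gS.toContMDiffRiemannianMetric hS)) =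
              ENNReal.ofReal (16 * Real.pi ^ 2) ∧
            Real.log 2 + Real.log Real.pi / 2 - 3 / 2 + δ' ≤ W ∧
            (∀ x : S, 0 < gS.scalarCurvature x) ∧
            (CompactSpace S → ∃ φ : S → M, ContMDiff (𝓡 4) (𝓡 4) ∞ φ ∧ Function.Injective φ ∧
              ∀ x : S, Function.Injective (mfderiv (𝓡 4) (𝓡 4) φ x)) := by
  intro hN1 M _ _ _ _ _ _ _ _ _ _ A gk covk xk δ' c hδ' hc hA hflow hRiem hcurv hpt hfloor
  obtain ⟨S, i1, i2, i3, i4, i5, i7, i8, i9, gS, iLC, f, hS, W, ι, kc, rc, Λc, gc, hf, hsol, hnorm,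
      hprob, hFW, hWneg, hdich, hcone, htrans, hconn, hcompl, hcouple⟩ :=
    hN1 M A gk covk xk (Real.log 2 + Real.log Real.pi / 2 - 3 / 2 + δ') c hc hA hflow hRiem hcurv hpt
      hfloor
  by_cases hι : Nonempty ι
  · -- ### a cone point leads to a contradiction with the entropy floor
    exfalso
    obtain ⟨i⟩ := hι
    obtain ⟨hk2, hrpos, hΛnn, hgcs, hgc0, -, -⟩ := hcone i
    exact coneBranch_false M A gk covk δ' hδ' hflow hRiem hfloor (kc i) hk2 (rc i) (Λc i) hrpos hΛnn (gc i)
      hgcs hgc0 (htrans i)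
  · -- ### no cone point: the export is r4's `stub_blowdownSoliton`
    haveI hιe : IsEmpty ι := not_nonempty_iff.mp hι
    haveI : ConnectedSpace S := hconn hιe
    have hRpos : ∀ x : S, 0 < gS.scalarCurvature x := hdich.resolve_right hι
    exact ⟨S, i1, i2, i3, i4, i5, inferInstance, i7, i8, i9, gS, iLC, f, hS, W, hcompl hιe, hf, hsol,
      hnorm, hprob, hFW, hRpos, fun hSc ↦ hcouple hιe hSc⟩


end Summit.SmoothPoincare4.SmoothPoincare4.Theorems.SubcylindricalRecognition.AncientSphereRigidity

end
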